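import Literature.NumberTheory.EllipticCurves.Curve5077aBGZWeightsEnclosureB
import Literature.NumberTheory.EllipticCurves.Curve5077aCoefficients
import Literature.NumberTheory.EllipticCurves.LFunctionCoefficientBound
import Mathlib.Analysis.SpecificLimits.Basic
import Mathlib.Analysis.Normed.Group.InfiniteSum
import HarnessLib

/-!
# The curve 5077a: the Buhler–Gross–Zagier sum `∑ aₙ ∫_1^∞ e^{-2πny/√5077}(log y)³ dy` is positive

Buhler–Gross–Zagier 1985, §4, (11), (14): for `E = 5077a`,
`Λ‴(E,1) = 2 ∑_{n≥1} aₙ ∫_1^∞ e^{-2πny/√N}(log y)³ dy` and `L‴(E,1)/3! = 1.7318…`, in particular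
`Λ‴(E,1) ≠ 0`. This file proves the SIGN of the series from the tree's exact ingredients:

* `WeierstrassCurve.abs_LFunction_le_sq` — `|aₙ(E)| ≤ n²` for every elliptic `E/ℚ` (Hasse at every
  prime, `abs_LFunction_prime_pow_le`, and multiplicativity);
* the kernel enclosures of the weights `I(n)` for `n ≤ 20` and the crude bounds for `21 ≤ n ≤ 49`
  (`Curve5077aBGZWeightsEnclosureA/B`), the coefficients `aₙ(E)`, `n ≤ 49`
  (`Curve5077aCoefficients`): `31.18 ≤ ∑_{n<50} aₙ I(n)` (`bgzSum_range_fifty_ge`);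
* the tail `|∑_{n≥50} aₙ I(n)| ≤ 5.8` from `|aₙ| I(n) ≤ n² · 6e^{-x₁n}/(x₁n)⁴ ≤ (6/(2500 x₁⁴)) e^{-x₁ n}`
  (`x₁ = 0.08818125 ≤ 2π/√5077`) and the geometric series;

whence `0 < ∑' n, aₙ(E) I(n)` (`bgzSum_pos`) and its summability (`summable_bgzSum`). The value
agrees with BGZ (14): `∑ aₙ I(n) = Λ‴(E,1)/2 ≈ 58.9`, i.e. `L‴(E,1) = (2π/√N) Λ‴ ≈ 10.39 = 6 · 1.7318`.
Everything is PROVED; no `def`, no named fact.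

## References
* J. P. Buhler, B. H. Gross, D. B. Zagier, Math. Comp. 44 (1985) 473–481, §4 (11), (14).
  [BuhlerGrossZagier1985]
* J. H. Silverman, *The Arithmetic of Elliptic Curves*, 2nd ed. (2009), Thm. V.1.1 (Hasse).
  [SilvermanAEC2009]
-/

open Real Set MeasureTheory Finset
open Literature.Analysis.ValidatedNumerics.ExpLogCube Literature.Analysis.ValidatedNumerics.ExpSum

namespace WeierstrassCurve

/-- **`|aₙ(E)| ≤ n²`** for every elliptic `E/ℚ` and every `n` (from Hasse's bound
`|a_{p^k}| ≤ (k+1) p^{k/2}` at every prime, tree theorem `abs_LFunction_prime_pow_le`, the crude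
`(k+1) √p^k ≤ p^k · p^k`, and multiplicativity). [cite: SilvermanAEC2009, Thm. V.1.1] -/
theorem abs_LFunction_le_sq (W : WeierstrassCurve ℚ) [W.IsElliptic] (n : ℕ) :
    |(W.LFunction n : ℝ)| ≤ (n : ℝ) ^ 2 := by
  rcases Nat.eq_zero_or_pos n with rfl | hn
  · simp
  have hmult := W.isMultiplicative_LFunction
  rw [hmult.multiplicative_factorization W.LFunction hn.ne']
  have hcast : (n : ℝ) = ∏ p ∈ n.factorization.support, (p : ℝ) ^ n.factorization p := by
    conv_lhs => rw [← Nat.prod_factorization_pow_eq_self hn.ne']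
    rw [Finsupp.prod, Nat.cast_prod]
    push_cast
    rfl
  rw [hcast, ← Finset.prod_pow, Finsupp.prod, Int.cast_prod, Finset.abs_prod]
  refine Finset.prod_le_prod (fun p _ ↦ abs_nonneg _) fun p hp ↦ ?_
  have hpp : p.Prime := Nat.prime_of_mem_primeFactors (Nat.support_factorization n ▸ hp)
  set k := n.factorization p
  refine (W.abs_LFunction_prime_pow_le hpp k).trans ?_
  have hp1 : (1 : ℝ) ≤ p := by exact_mod_cast hpp.one_lt.le
  have hsqrt : Real.sqrt p ≤ p := by
    rw [Real.sqrt_le_left (by linarith)]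
    nlinarith
  have h1 : (k + 1 : ℝ) ≤ (p : ℝ) ^ k := by
    have h2k : k + 1 ≤ 2 ^ k := Nat.lt_two_pow_self
    calc (k + 1 : ℝ) ≤ (2 : ℝ) ^ k := by exact_mod_cast h2k
      _ ≤ (p : ℝ) ^ k := pow_le_pow_left₀ (by norm_num) (by exact_mod_cast hpp.two_le) k
  have h2 : Real.sqrt p ^ k ≤ (p : ℝ) ^ k := pow_le_pow_left₀ (Real.sqrt_nonneg _) hsqrt k
  calc (k + 1 : ℝ) * Real.sqrt p ^ k ≤ (p : ℝ) ^ k * (p : ℝ) ^ k :=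
        mul_le_mul h1 h2 (pow_nonneg (Real.sqrt_nonneg _) k) (pow_nonneg (by linarith) k)
    _ = ((p : ℝ) ^ k) ^ 2 := by ring

end WeierstrassCurve

namespace Literature.NumberTheory.EllipticCurves.Curve5077a

open WeierstrassCurve

/-! ### The finite part `n < 50` -/

/-- Termwise lower bound for `n = 0` of the BGZ sum (coefficient `a_0` times the enclosure of `I(0)`). [cite: BuhlerGrossZagier1985, §4 (11)] -/
private theorem term_ge_0 : (0 : ℝ) ≤ (E.LFunction 0 : ℝ) * logCubeIntegral (2 * Real.pi * ((0 : ℕ) : ℝ) * (Real.sqrt 5077)⁻¹) := by simp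

/-- Termwise lower bound for `n = 1` of the BGZ sum (coefficient `a_1` times the enclosure of `I(1)`). [cite: BuhlerGrossZagier1985, §4 (11)] -/
private theorem term_ge_1 : (18305899 : ℝ) / 125000 ≤ (E.LFunction 1 : ℝ) *
    logCubeIntegral (2 * Real.pi * ((1 : ℕ) : ℝ) * (Real.sqrt 5077)⁻¹) := by
  rw [LFunction_E_1]; have h := bgzWeight_bounds_1.1; push_cast at h ⊢; linarith

/-- Termwise lower bound for `n = 2` of the BGZ sum (coefficient `a_2` times the enclosure of `I(2)`). [cite: BuhlerGrossZagier1985, §4 (11)] -/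
private theorem term_ge_2 : (-35742827 : ℝ) / 500000 ≤ (E.LFunction 2 : ℝ) *
    logCubeIntegral (2 * Real.pi * ((2 : ℕ) : ℝ) * (Real.sqrt 5077)⁻¹) := by
  rw [LFunction_E_2]; have h := bgzWeight_bounds_2.2; push_cast at h ⊢; linarith

/-- Termwise lower bound for `n = 3` of the BGZ sum (coefficient `a_3` times the enclosure of `I(3)`). [cite: BuhlerGrossZagier1985, §4 (11)] -/
private theorem term_ge_3 : (-10424457 : ℝ) / 250000 ≤ (E.LFunction 3 : ℝ) *
    logCubeIntegral (2 * Real.pi * ((3 : ℕ) : ℝ) * (Real.sqrt 5077)⁻¹) := by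
  rw [LFunction_E_3]; have h := bgzWeight_bounds_3.2; push_cast at h ⊢; linarith

/-- Termwise lower bound for `n = 4` of the BGZ sum (coefficient `a_4` times the enclosure of `I(4)`). [cite: BuhlerGrossZagier1985, §4 (11)] -/
private theorem term_ge_4 : (161751 : ℝ) / 15625 ≤ (E.LFunction 4 : ℝ) *
    logCubeIntegral (2 * Real.pi * ((4 : ℕ) : ℝ) * (Real.sqrt 5077)⁻¹) := by
  rw [LFunction_E_4]; have h := bgzWeight_bounds_4.1; push_cast at h ⊢; linarith

/-- Termwise lower bound for `n = 5` of the BGZ sum (coefficient `a_5` times the enclosure of `I(5)`). [cite: BuhlerGrossZagier1985, §4 (11)] -/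
private theorem term_ge_5 : (-3573371 : ℝ) / 250000 ≤ (E.LFunction 5 : ℝ) *
    logCubeIntegral (2 * Real.pi * ((5 : ℕ) : ℝ) * (Real.sqrt 5077)⁻¹) := by
  rw [LFunction_E_5]; have h := bgzWeight_bounds_5.2; push_cast at h ⊢; linarith

/-- Termwise lower bound for `n = 6` of the BGZ sum (coefficient `a_6` times the enclosure of `I(6)`). [cite: BuhlerGrossZagier1985, §4 (11)] -/
private theorem term_ge_6 : (2366889 : ℝ) / 250000 ≤ (E.LFunction 6 : ℝ) *
    logCubeIntegral (2 * Real.pi * ((6 : ℕ) : ℝ) * (Real.sqrt 5077)⁻¹) := by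
  rw [LFunction_E_6]; have h := bgzWeight_bounds_6.1; push_cast at h ⊢; linarith

/-- Termwise lower bound for `n = 7` of the BGZ sum (coefficient `a_7` times the enclosure of `I(7)`). [cite: BuhlerGrossZagier1985, §4 (11)] -/
private theorem term_ge_7 : (-1443791 : ℝ) / 250000 ≤ (E.LFunction 7 : ℝ) *
    logCubeIntegral (2 * Real.pi * ((7 : ℕ) : ℝ) * (Real.sqrt 5077)⁻¹) := by
  rw [LFunction_E_7]; have h := bgzWeight_bounds_7.2; push_cast at h ⊢; linarith

/-- Termwise lower bound for `n = 8` of the BGZ sum (coefficient `a_8` times the enclosure of `I(8)`). [cite: BuhlerGrossZagier1985, §4 (11)] -/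
private theorem term_ge_8 : (0 : ℝ) ≤ (E.LFunction 8 : ℝ) *
    logCubeIntegral (2 * Real.pi * ((8 : ℕ) : ℝ) * (Real.sqrt 5077)⁻¹) := by
  rw [LFunction_E_8]; simp

/-- Termwise lower bound for `n = 9` of the BGZ sum (coefficient `a_9` times the enclosure of `I(9)`). [cite: BuhlerGrossZagier1985, §4 (11)] -/
private theorem term_ge_9 : (1120191 : ℝ) / 500000 ≤ (E.LFunction 9 : ℝ) *
    logCubeIntegral (2 * Real.pi * ((9 : ℕ) : ℝ) * (Real.sqrt 5077)⁻¹) := by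
  rw [LFunction_E_9]; have h := bgzWeight_bounds_9.1; push_cast at h ⊢; linarith

/-- Termwise lower bound for `n = 10` of the BGZ sum (coefficient `a_10` times the enclosure of `I(10)`). [cite: BuhlerGrossZagier1985, §4 (11)] -/
private theorem term_ge_10 : (50849 : ℝ) / 25000 ≤ (E.LFunction 10 : ℝ) *
    logCubeIntegral (2 * Real.pi * ((10 : ℕ) : ℝ) * (Real.sqrt 5077)⁻¹) := by
  rw [LFunction_E_10]; have h := bgzWeight_bounds_10.1; push_cast at h ⊢; linarith

/-- Termwise lower bound for `n = 11` of the BGZ sum (coefficient `a_11` times the enclosure of `I(11)`). [cite: BuhlerGrossZagier1985, §4 (11)] -/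
private theorem term_ge_11 : (-244221 : ℝ) / 125000 ≤ (E.LFunction 11 : ℝ) *
    logCubeIntegral (2 * Real.pi * ((11 : ℕ) : ℝ) * (Real.sqrt 5077)⁻¹) := by
  rw [LFunction_E_11]; have h := bgzWeight_bounds_11.2; push_cast at h ⊢; linarith

/-- Termwise lower bound for `n = 12` of the BGZ sum (coefficient `a_12` times the enclosure of `I(12)`). [cite: BuhlerGrossZagier1985, §4 (11)] -/
private theorem term_ge_12 : (-714069 : ℝ) / 500000 ≤ (E.LFunction 12 : ℝ) *
    logCubeIntegral (2 * Real.pi * ((12 : ℕ) : ℝ) * (Real.sqrt 5077)⁻¹) := by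
  rw [LFunction_E_12]; have h := bgzWeight_bounds_12.2; push_cast at h ⊢; linarith

/-- Termwise lower bound for `n = 13` of the BGZ sum (coefficient `a_13` times the enclosure of `I(13)`). [cite: BuhlerGrossZagier1985, §4 (11)] -/
private theorem term_ge_13 : (-88423 : ℝ) / 125000 ≤ (E.LFunction 13 : ℝ) *
    logCubeIntegral (2 * Real.pi * ((13 : ℕ) : ℝ) * (Real.sqrt 5077)⁻¹) := by
  rw [LFunction_E_13]; have h := bgzWeight_bounds_13.2; push_cast at h ⊢; linarith

/-- Termwise lower bound for `n = 14` of the BGZ sum (coefficient `a_14` times the enclosure of `I(14)`). [cite: BuhlerGrossZagier1985, §4 (11)] -/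
private theorem term_ge_14 : (13387 : ℝ) / 25000 ≤ (E.LFunction 14 : ℝ) *
    logCubeIntegral (2 * Real.pi * ((14 : ℕ) : ℝ) * (Real.sqrt 5077)⁻¹) := by
  rw [LFunction_E_14]; have h := bgzWeight_bounds_14.1; push_cast at h ⊢; linarith

/-- Termwise lower bound for `n = 15` of the BGZ sum (coefficient `a_15` times the enclosure of `I(15)`). [cite: BuhlerGrossZagier1985, §4 (11)] -/
private theorem term_ge_15 : (74637 : ℝ) / 125000 ≤ (E.LFunction 15 : ℝ) *
    logCubeIntegral (2 * Real.pi * ((15 : ℕ) : ℝ) * (Real.sqrt 5077)⁻¹) := by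
  rw [LFunction_E_15]; have h := bgzWeight_bounds_15.1; push_cast at h ⊢; linarith

/-- Termwise lower bound for `n = 16` of the BGZ sum (coefficient `a_16` times the enclosure of `I(16)`). [cite: BuhlerGrossZagier1985, §4 (11)] -/
private theorem term_ge_16 : (-6639 : ℝ) / 15625 ≤ (E.LFunction 16 : ℝ) *
    logCubeIntegral (2 * Real.pi * ((16 : ℕ) : ℝ) * (Real.sqrt 5077)⁻¹) := by
  rw [LFunction_E_16]; have h := bgzWeight_bounds_16.2; push_cast at h ⊢; linarith

/-- Termwise lower bound for `n = 17` of the BGZ sum (coefficient `a_17` times the enclosure of `I(17)`). [cite: BuhlerGrossZagier1985, §4 (11)] -/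
private theorem term_ge_17 : (-83619 : ℝ) / 250000 ≤ (E.LFunction 17 : ℝ) *
    logCubeIntegral (2 * Real.pi * ((17 : ℕ) : ℝ) * (Real.sqrt 5077)⁻¹) := by
  rw [LFunction_E_17]; have h := bgzWeight_bounds_17.2; push_cast at h ⊢; linarith

/-- Termwise lower bound for `n = 18` of the BGZ sum (coefficient `a_18` times the enclosure of `I(18)`). [cite: BuhlerGrossZagier1985, §4 (11)] -/
private theorem term_ge_18 : (-99579 : ℝ) / 125000 ≤ (E.LFunction 18 : ℝ) *
    logCubeIntegral (2 * Real.pi * ((18 : ℕ) : ℝ) * (Real.sqrt 5077)⁻¹) := by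
  rw [LFunction_E_18]; have h := bgzWeight_bounds_18.2; push_cast at h ⊢; linarith

/-- Termwise lower bound for `n = 19` of the BGZ sum (coefficient `a_19` times the enclosure of `I(19)`). [cite: BuhlerGrossZagier1985, §4 (11)] -/
private theorem term_ge_19 : (-37177 : ℝ) / 100000 ≤ (E.LFunction 19 : ℝ) *
    logCubeIntegral (2 * Real.pi * ((19 : ℕ) : ℝ) * (Real.sqrt 5077)⁻¹) := by
  rw [LFunction_E_19]; have h := bgzWeight_bounds_19.2; push_cast at h ⊢; linarith

/-- Termwise lower bound for `n = 20` of the BGZ sum (coefficient `a_20` times the enclosure of `I(20)`). [cite: BuhlerGrossZagier1985, §4 (11)] -/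
private theorem term_ge_20 : (-5348 : ℝ) / 15625 ≤ (E.LFunction 20 : ℝ) *
    logCubeIntegral (2 * Real.pi * ((20 : ℕ) : ℝ) * (Real.sqrt 5077)⁻¹) := by
  rw [LFunction_E_20]; have h := bgzWeight_bounds_20.2; push_cast at h ⊢; linarith

/-- Termwise lower bound for `n = 21` of the BGZ sum (coefficient `a_21` times the enclosure of `I(21)`). [cite: BuhlerGrossZagier1985, §4 (11)] -/
private theorem term_ge_21 : (0 : ℝ) ≤ (E.LFunction 21 : ℝ) *
    logCubeIntegral (2 * Real.pi * ((21 : ℕ) : ℝ) * (Real.sqrt 5077)⁻¹) := by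
  rw [LFunction_E_21]; have h := logCubeIntegral_nonneg (2 * Real.pi * ((21 : ℕ) : ℝ) * (Real.sqrt 5077)⁻¹)
  push_cast at h ⊢; positivity

/-- Termwise lower bound for `n = 22` of the BGZ sum (coefficient `a_22` times the enclosure of `I(22)`). [cite: BuhlerGrossZagier1985, §4 (11)] -/
private theorem term_ge_22 : (0 : ℝ) ≤ (E.LFunction 22 : ℝ) *
    logCubeIntegral (2 * Real.pi * ((22 : ℕ) : ℝ) * (Real.sqrt 5077)⁻¹) := by
  rw [LFunction_E_22]; have h := logCubeIntegral_nonneg (2 * Real.pi * ((22 : ℕ) : ℝ) * (Real.sqrt 5077)⁻¹)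
  push_cast at h ⊢; positivity

/-- Termwise lower bound for `n = 23` of the BGZ sum (coefficient `a_23` times the enclosure of `I(23)`). [cite: BuhlerGrossZagier1985, §4 (11)] -/
private theorem term_ge_23 : (-699849 : ℝ) / 2500000 ≤ (E.LFunction 23 : ℝ) *
    logCubeIntegral (2 * Real.pi * ((23 : ℕ) : ℝ) * (Real.sqrt 5077)⁻¹) := by
  rw [LFunction_E_23]; have h := bgzWeight_le_23; push_cast at h ⊢; linarith

/-- Termwise lower bound for `n = 24` of the BGZ sum (coefficient `a_24` times the enclosure of `I(24)`). [cite: BuhlerGrossZagier1985, §4 (11)] -/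
private theorem term_ge_24 : (0 : ℝ) ≤ (E.LFunction 24 : ℝ) *
    logCubeIntegral (2 * Real.pi * ((24 : ℕ) : ℝ) * (Real.sqrt 5077)⁻¹) := by
  rw [LFunction_E_24]; simp

/-- Termwise lower bound for `n = 25` of the BGZ sum (coefficient `a_25` times the enclosure of `I(25)`). [cite: BuhlerGrossZagier1985, §4 (11)] -/
private theorem term_ge_25 : (0 : ℝ) ≤ (E.LFunction 25 : ℝ) *
    logCubeIntegral (2 * Real.pi * ((25 : ℕ) : ℝ) * (Real.sqrt 5077)⁻¹) := by
  rw [LFunction_E_25]; have h := logCubeIntegral_nonneg (2 * Real.pi * ((25 : ℕ) : ℝ) * (Real.sqrt 5077)⁻¹)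
  push_cast at h ⊢; positivity

/-- Termwise lower bound for `n = 26` of the BGZ sum (coefficient `a_26` times the enclosure of `I(26)`). [cite: BuhlerGrossZagier1985, §4 (11)] -/
private theorem term_ge_26 : (0 : ℝ) ≤ (E.LFunction 26 : ℝ) *
    logCubeIntegral (2 * Real.pi * ((26 : ℕ) : ℝ) * (Real.sqrt 5077)⁻¹) := by
  rw [LFunction_E_26]; have h := logCubeIntegral_nonneg (2 * Real.pi * ((26 : ℕ) : ℝ) * (Real.sqrt 5077)⁻¹)
  push_cast at h ⊢; positivity

/-- Termwise lower bound for `n = 27` of the BGZ sum (coefficient `a_27` times the enclosure of `I(27)`). [cite: BuhlerGrossZagier1985, §4 (11)] -/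
private theorem term_ge_27 : (-1553913 : ℝ) / 10000000 ≤ (E.LFunction 27 : ℝ) *
    logCubeIntegral (2 * Real.pi * ((27 : ℕ) : ℝ) * (Real.sqrt 5077)⁻¹) := by
  rw [LFunction_E_27]; have h := bgzWeight_le_27; push_cast at h ⊢; linarith

/-- Termwise lower bound for `n = 28` of the BGZ sum (coefficient `a_28` times the enclosure of `I(28)`). [cite: BuhlerGrossZagier1985, §4 (11)] -/
private theorem term_ge_28 : (-68341 : ℝ) / 625000 ≤ (E.LFunction 28 : ℝ) *
    logCubeIntegral (2 * Real.pi * ((28 : ℕ) : ℝ) * (Real.sqrt 5077)⁻¹) := by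
  rw [LFunction_E_28]; have h := bgzWeight_le_28; push_cast at h ⊢; linarith

/-- Termwise lower bound for `n = 29` of the BGZ sum (coefficient `a_29` times the enclosure of `I(29)`). [cite: BuhlerGrossZagier1985, §4 (11)] -/
private theorem term_ge_29 : (-81567 : ℝ) / 1250000 ≤ (E.LFunction 29 : ℝ) *
    logCubeIntegral (2 * Real.pi * ((29 : ℕ) : ℝ) * (Real.sqrt 5077)⁻¹) := by
  rw [LFunction_E_29]; have h := bgzWeight_le_29; push_cast at h ⊢; linarith

/-- Termwise lower bound for `n = 30` of the BGZ sum (coefficient `a_30` times the enclosure of `I(30)`). [cite: BuhlerGrossZagier1985, §4 (11)] -/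
private theorem term_ge_30 : (-260847 : ℝ) / 1250000 ≤ (E.LFunction 30 : ℝ) *
    logCubeIntegral (2 * Real.pi * ((30 : ℕ) : ℝ) * (Real.sqrt 5077)⁻¹) := by
  rw [LFunction_E_30]; have h := bgzWeight_le_30; push_cast at h ⊢; linarith

/-- Termwise lower bound for `n = 31` of the BGZ sum (coefficient `a_31` times the enclosure of `I(31)`). [cite: BuhlerGrossZagier1985, §4 (11)] -/
private theorem term_ge_31 : (-1091 : ℝ) / 78125 ≤ (E.LFunction 31 : ℝ) *
    logCubeIntegral (2 * Real.pi * ((31 : ℕ) : ℝ) * (Real.sqrt 5077)⁻¹) := by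
  rw [LFunction_E_31]; have h := bgzWeight_le_31; push_cast at h ⊢; linarith

/-- Termwise lower bound for `n = 32` of the BGZ sum (coefficient `a_32` times the enclosure of `I(32)`). [cite: BuhlerGrossZagier1985, §4 (11)] -/
private theorem term_ge_32 : (0 : ℝ) ≤ (E.LFunction 32 : ℝ) *
    logCubeIntegral (2 * Real.pi * ((32 : ℕ) : ℝ) * (Real.sqrt 5077)⁻¹) := by
  rw [LFunction_E_32]; have h := logCubeIntegral_nonneg (2 * Real.pi * ((32 : ℕ) : ℝ) * (Real.sqrt 5077)⁻¹)
  push_cast at h ⊢; positivity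

/-- Termwise lower bound for `n = 33` of the BGZ sum (coefficient `a_33` times the enclosure of `I(33)`). [cite: BuhlerGrossZagier1985, §4 (11)] -/
private theorem term_ge_33 : (0 : ℝ) ≤ (E.LFunction 33 : ℝ) *
    logCubeIntegral (2 * Real.pi * ((33 : ℕ) : ℝ) * (Real.sqrt 5077)⁻¹) := by
  rw [LFunction_E_33]; have h := logCubeIntegral_nonneg (2 * Real.pi * ((33 : ℕ) : ℝ) * (Real.sqrt 5077)⁻¹)
  push_cast at h ⊢; positivity

/-- Termwise lower bound for `n = 34` of the BGZ sum (coefficient `a_34` times the enclosure of `I(34)`). [cite: BuhlerGrossZagier1985, §4 (11)] -/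
private theorem term_ge_34 : (0 : ℝ) ≤ (E.LFunction 34 : ℝ) *
    logCubeIntegral (2 * Real.pi * ((34 : ℕ) : ℝ) * (Real.sqrt 5077)⁻¹) := by
  rw [LFunction_E_34]; have h := logCubeIntegral_nonneg (2 * Real.pi * ((34 : ℕ) : ℝ) * (Real.sqrt 5077)⁻¹)
  push_cast at h ⊢; positivity

/-- Termwise lower bound for `n = 35` of the BGZ sum (coefficient `a_35` times the enclosure of `I(35)`). [cite: BuhlerGrossZagier1985, §4 (11)] -/
private theorem term_ge_35 : (0 : ℝ) ≤ (E.LFunction 35 : ℝ) *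
    logCubeIntegral (2 * Real.pi * ((35 : ℕ) : ℝ) * (Real.sqrt 5077)⁻¹) := by
  rw [LFunction_E_35]; have h := logCubeIntegral_nonneg (2 * Real.pi * ((35 : ℕ) : ℝ) * (Real.sqrt 5077)⁻¹)
  push_cast at h ⊢; positivity

/-- Termwise lower bound for `n = 36` of the BGZ sum (coefficient `a_36` times the enclosure of `I(36)`). [cite: BuhlerGrossZagier1985, §4 (11)] -/
private theorem term_ge_36 : (0 : ℝ) ≤ (E.LFunction 36 : ℝ) *
    logCubeIntegral (2 * Real.pi * ((36 : ℕ) : ℝ) * (Real.sqrt 5077)⁻¹) := by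
  rw [LFunction_E_36]; have h := logCubeIntegral_nonneg (2 * Real.pi * ((36 : ℕ) : ℝ) * (Real.sqrt 5077)⁻¹)
  push_cast at h ⊢; positivity

/-- Termwise lower bound for `n = 37` of the BGZ sum (coefficient `a_37` times the enclosure of `I(37)`). [cite: BuhlerGrossZagier1985, §4 (11)] -/
private theorem term_ge_37 : (0 : ℝ) ≤ (E.LFunction 37 : ℝ) *
    logCubeIntegral (2 * Real.pi * ((37 : ℕ) : ℝ) * (Real.sqrt 5077)⁻¹) := by
  rw [LFunction_E_37]; simp

/-- Termwise lower bound for `n = 38` of the BGZ sum (coefficient `a_38` times the enclosure of `I(38)`). [cite: BuhlerGrossZagier1985, §4 (11)] -/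
private theorem term_ge_38 : (0 : ℝ) ≤ (E.LFunction 38 : ℝ) *
    logCubeIntegral (2 * Real.pi * ((38 : ℕ) : ℝ) * (Real.sqrt 5077)⁻¹) := by
  rw [LFunction_E_38]; have h := logCubeIntegral_nonneg (2 * Real.pi * ((38 : ℕ) : ℝ) * (Real.sqrt 5077)⁻¹)
  push_cast at h ⊢; positivity

/-- Termwise lower bound for `n = 39` of the BGZ sum (coefficient `a_39` times the enclosure of `I(39)`). [cite: BuhlerGrossZagier1985, §4 (11)] -/
private theorem term_ge_39 : (0 : ℝ) ≤ (E.LFunction 39 : ℝ) *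
    logCubeIntegral (2 * Real.pi * ((39 : ℕ) : ℝ) * (Real.sqrt 5077)⁻¹) := by
  rw [LFunction_E_39]; have h := logCubeIntegral_nonneg (2 * Real.pi * ((39 : ℕ) : ℝ) * (Real.sqrt 5077)⁻¹)
  push_cast at h ⊢; positivity

/-- Termwise lower bound for `n = 40` of the BGZ sum (coefficient `a_40` times the enclosure of `I(40)`). [cite: BuhlerGrossZagier1985, §4 (11)] -/
private theorem term_ge_40 : (0 : ℝ) ≤ (E.LFunction 40 : ℝ) *
    logCubeIntegral (2 * Real.pi * ((40 : ℕ) : ℝ) * (Real.sqrt 5077)⁻¹) := by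
  rw [LFunction_E_40]; simp

/-- Termwise lower bound for `n = 41` of the BGZ sum (coefficient `a_41` times the enclosure of `I(41)`). [cite: BuhlerGrossZagier1985, §4 (11)] -/
private theorem term_ge_41 : (0 : ℝ) ≤ (E.LFunction 41 : ℝ) *
    logCubeIntegral (2 * Real.pi * ((41 : ℕ) : ℝ) * (Real.sqrt 5077)⁻¹) := by
  rw [LFunction_E_41]; simp

/-- Termwise lower bound for `n = 42` of the BGZ sum (coefficient `a_42` times the enclosure of `I(42)`). [cite: BuhlerGrossZagier1985, §4 (11)] -/
private theorem term_ge_42 : (-1473 : ℝ) / 78125 ≤ (E.LFunction 42 : ℝ) *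
    logCubeIntegral (2 * Real.pi * ((42 : ℕ) : ℝ) * (Real.sqrt 5077)⁻¹) := by
  rw [LFunction_E_42]; have h := bgzWeight_le_42; push_cast at h ⊢; linarith

/-- Termwise lower bound for `n = 43` of the BGZ sum (coefficient `a_43` times the enclosure of `I(43)`). [cite: BuhlerGrossZagier1985, §4 (11)] -/
private theorem term_ge_43 : (-6547 : ℝ) / 1250000 ≤ (E.LFunction 43 : ℝ) *
    logCubeIntegral (2 * Real.pi * ((43 : ℕ) : ℝ) * (Real.sqrt 5077)⁻¹) := by
  rw [LFunction_E_43]; have h := bgzWeight_le_43; push_cast at h ⊢; linarith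

/-- Termwise lower bound for `n = 44` of the BGZ sum (coefficient `a_44` times the enclosure of `I(44)`). [cite: BuhlerGrossZagier1985, §4 (11)] -/
private theorem term_ge_44 : (-4101 : ℝ) / 625000 ≤ (E.LFunction 44 : ℝ) *
    logCubeIntegral (2 * Real.pi * ((44 : ℕ) : ℝ) * (Real.sqrt 5077)⁻¹) := by
  rw [LFunction_E_44]; have h := bgzWeight_le_44; push_cast at h ⊢; linarith

/-- Termwise lower bound for `n = 45` of the BGZ sum (coefficient `a_45` times the enclosure of `I(45)`). [cite: BuhlerGrossZagier1985, §4 (11)] -/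
private theorem term_ge_45 : (-858 : ℝ) / 78125 ≤ (E.LFunction 45 : ℝ) *
    logCubeIntegral (2 * Real.pi * ((45 : ℕ) : ℝ) * (Real.sqrt 5077)⁻¹) := by
  rw [LFunction_E_45]; have h := bgzWeight_le_45; push_cast at h ⊢; linarith

/-- Termwise lower bound for `n = 46` of the BGZ sum (coefficient `a_46` times the enclosure of `I(46)`). [cite: BuhlerGrossZagier1985, §4 (11)] -/
private theorem term_ge_46 : (0 : ℝ) ≤ (E.LFunction 46 : ℝ) *
    logCubeIntegral (2 * Real.pi * ((46 : ℕ) : ℝ) * (Real.sqrt 5077)⁻¹) := by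
  rw [LFunction_E_46]; have h := logCubeIntegral_nonneg (2 * Real.pi * ((46 : ℕ) : ℝ) * (Real.sqrt 5077)⁻¹)
  push_cast at h ⊢; positivity

/-- Termwise lower bound for `n = 47` of the BGZ sum (coefficient `a_47` times the enclosure of `I(47)`). [cite: BuhlerGrossZagier1985, §4 (11)] -/
private theorem term_ge_47 : (-3627 : ℝ) / 1250000 ≤ (E.LFunction 47 : ℝ) *
    logCubeIntegral (2 * Real.pi * ((47 : ℕ) : ℝ) * (Real.sqrt 5077)⁻¹) := by
  rw [LFunction_E_47]; have h := bgzWeight_le_47; push_cast at h ⊢; linarith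

/-- Termwise lower bound for `n = 48` of the BGZ sum (coefficient `a_48` times the enclosure of `I(48)`). [cite: BuhlerGrossZagier1985, §4 (11)] -/
private theorem term_ge_48 : (0 : ℝ) ≤ (E.LFunction 48 : ℝ) *
    logCubeIntegral (2 * Real.pi * ((48 : ℕ) : ℝ) * (Real.sqrt 5077)⁻¹) := by
  rw [LFunction_E_48]; have h := logCubeIntegral_nonneg (2 * Real.pi * ((48 : ℕ) : ℝ) * (Real.sqrt 5077)⁻¹)
  push_cast at h ⊢; positivity

/-- Termwise lower bound for `n = 49` of the BGZ sum (coefficient `a_49` times the enclosure of `I(49)`). [cite: BuhlerGrossZagier1985, §4 (11)] -/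
private theorem term_ge_49 : (0 : ℝ) ≤ (E.LFunction 49 : ℝ) *
    logCubeIntegral (2 * Real.pi * ((49 : ℕ) : ℝ) * (Real.sqrt 5077)⁻¹) := by
  rw [LFunction_E_49]; have h := logCubeIntegral_nonneg (2 * Real.pi * ((49 : ℕ) : ℝ) * (Real.sqrt 5077)⁻¹)
  push_cast at h ⊢; positivity

/-- **`31.18 ≤ ∑_{n<50} aₙ(E) I(n)`**, `I(n) = ∫_1^∞ e^{-2πny/√5077}(log y)³ dy`: each term is bounded
below by `aₙ · LB(n)` (`aₙ > 0`) or `aₙ · UB(n)` (`aₙ < 0`) from the kernel enclosures, `0` when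
`aₙ = 0` or (`n ≥ 21`, `aₙ > 0`). [cite: BuhlerGrossZagier1985, §4 (11), (14)] -/
theorem bgzSum_range_fifty_ge :
    (31 : ℝ) ≤ ∑ n ∈ Finset.range 50,
      (E.LFunction n : ℝ) * logCubeIntegral (2 * Real.pi * (n : ℝ) * (Real.sqrt 5077)⁻¹) := by
  set T : ℕ → ℝ := fun n ↦
    (E.LFunction n : ℝ) * logCubeIntegral (2 * Real.pi * (n : ℝ) * (Real.sqrt 5077)⁻¹) with hT
  have step : ∀ (k k1 : ℕ) (A c : ℝ), k1 = k + 1 → A ≤ ∑ n ∈ Finset.range k, T n → c ≤ T k →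
      A + c ≤ ∑ n ∈ Finset.range k1, T n := by
    intro k k1 A c hk hA hc
    rw [hk, Finset.sum_range_succ]
    exact add_le_add hA hc
  have s0 : (0 : ℝ) ≤ ∑ n ∈ Finset.range 0, T n := by simp
  have s1 := step 0 1 _ _ rfl s0 term_ge_0
  have s2 := step 1 2 _ _ rfl s1 term_ge_1
  have s3 := step 2 3 _ _ rfl s2 term_ge_2
  have s4 := step 3 4 _ _ rfl s3 term_ge_3
  have s5 := step 4 5 _ _ rfl s4 term_ge_4
  have s6 := step 5 6 _ _ rfl s5 term_ge_5
  have s7 := step 6 7 _ _ rfl s6 term_ge_6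
  have s8 := step 7 8 _ _ rfl s7 term_ge_7
  have s9 := step 8 9 _ _ rfl s8 term_ge_8
  have s10 := step 9 10 _ _ rfl s9 term_ge_9
  have s11 := step 10 11 _ _ rfl s10 term_ge_10
  have s12 := step 11 12 _ _ rfl s11 term_ge_11
  have s13 := step 12 13 _ _ rfl s12 term_ge_12
  have s14 := step 13 14 _ _ rfl s13 term_ge_13
  have s15 := step 14 15 _ _ rfl s14 term_ge_14
  have s16 := step 15 16 _ _ rfl s15 term_ge_15
  have s17 := step 16 17 _ _ rfl s16 term_ge_16
  have s18 := step 17 18 _ _ rfl s17 term_ge_17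
  have s19 := step 18 19 _ _ rfl s18 term_ge_18
  have s20 := step 19 20 _ _ rfl s19 term_ge_19
  have s21 := step 20 21 _ _ rfl s20 term_ge_20
  have s22 := step 21 22 _ _ rfl s21 term_ge_21
  have s23 := step 22 23 _ _ rfl s22 term_ge_22
  have s24 := step 23 24 _ _ rfl s23 term_ge_23
  have s25 := step 24 25 _ _ rfl s24 term_ge_24
  have s26 := step 25 26 _ _ rfl s25 term_ge_25
  have s27 := step 26 27 _ _ rfl s26 term_ge_26
  have s28 := step 27 28 _ _ rfl s27 term_ge_27
  have s29 := step 28 29 _ _ rfl s28 term_ge_28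
  have s30 := step 29 30 _ _ rfl s29 term_ge_29
  have s31 := step 30 31 _ _ rfl s30 term_ge_30
  have s32 := step 31 32 _ _ rfl s31 term_ge_31
  have s33 := step 32 33 _ _ rfl s32 term_ge_32
  have s34 := step 33 34 _ _ rfl s33 term_ge_33
  have s35 := step 34 35 _ _ rfl s34 term_ge_34
  have s36 := step 35 36 _ _ rfl s35 term_ge_35
  have s37 := step 36 37 _ _ rfl s36 term_ge_36
  have s38 := step 37 38 _ _ rfl s37 term_ge_37
  have s39 := step 38 39 _ _ rfl s38 term_ge_38
  have s40 := step 39 40 _ _ rfl s39 term_ge_39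
  have s41 := step 40 41 _ _ rfl s40 term_ge_40
  have s42 := step 41 42 _ _ rfl s41 term_ge_41
  have s43 := step 42 43 _ _ rfl s42 term_ge_42
  have s44 := step 43 44 _ _ rfl s43 term_ge_43
  have s45 := step 44 45 _ _ rfl s44 term_ge_44
  have s46 := step 45 46 _ _ rfl s45 term_ge_45
  have s47 := step 46 47 _ _ rfl s46 term_ge_46
  have s48 := step 47 48 _ _ rfl s47 term_ge_47
  have s49 := step 48 49 _ _ rfl s48 term_ge_48
  have s50 := step 49 50 _ _ rfl s49 term_ge_49
  exact le_trans (by norm_num) s50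

/-! ### The tail `n ≥ 50` and the sign of the series -/

/-- Termwise bound `|aₙ I(n)| ≤ (6/(2500 x₁⁴)) x₁… `: precisely, for `n ≥ 50`,
`|aₙ(E) I(n)| ≤ C · q^n` with `q = e^{-x₁}`, `x₁ = 8818125/10⁸`, `C = 6/(2500 x₁⁴)` (from
`|aₙ| ≤ n²`, `I(n) ≤ 6 e^{-y}/y⁴` at `y = x₁ n ≤ 2πn/√5077`). [cite: BuhlerGrossZagier1985, §4 (11)] -/
theorem abs_bgzTerm_le {n : ℕ} (hn : 50 ≤ n) :
    |(E.LFunction n : ℝ) * logCubeIntegral (2 * Real.pi * (n : ℝ) * (Real.sqrt 5077)⁻¹)| ≤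
      6 / (2500 * ((8818125 : ℝ) / 100000000) ^ 4) *
        Real.exp (-((8818125 : ℝ) / 100000000)) ^ n := by
  set x₁ : ℝ := (8818125 : ℝ) / 100000000 with hx₁
  have hx : 0 < x₁ := by rw [hx₁]; norm_num
  have hn0 : (0 : ℝ) < n := by exact_mod_cast (show 0 < n by omega)
  have hn50 : (50 : ℝ) ≤ n := by exact_mod_cast hn
  obtain ⟨hxlo, _⟩ := two_pi_div_sqrt_bounds
  have hy : 0 < x₁ * n := mul_pos hx hn0
  have hylo : x₁ * n ≤ 2 * Real.pi * (n : ℝ) * (Real.sqrt 5077)⁻¹ := by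
    have h := mul_le_mul_of_nonneg_left hxlo hn0.le
    calc x₁ * n = n * (8818125 / 100000000) := by rw [hx₁]; ring
      _ ≤ n * (2 * Real.pi * (Real.sqrt 5077)⁻¹) := h
      _ = 2 * Real.pi * (n : ℝ) * (Real.sqrt 5077)⁻¹ := by ring
  have hI0 : 0 ≤ logCubeIntegral (2 * Real.pi * (n : ℝ) * (Real.sqrt 5077)⁻¹) :=
    logCubeIntegral_nonneg _
  have hI : logCubeIntegral (2 * Real.pi * (n : ℝ) * (Real.sqrt 5077)⁻¹) ≤
      6 * Real.exp (-(x₁ * n)) / (x₁ * n) ^ 4 :=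
    (logCubeIntegral_antitone hy hylo).trans (logCubeIntegral_le_crude hy)
  have ha : |(E.LFunction n : ℝ)| ≤ (n : ℝ) ^ 2 := E.abs_LFunction_le_sq n
  rw [abs_mul, abs_of_nonneg hI0]
  have hexp : Real.exp (-(x₁ * n)) = Real.exp (-x₁) ^ n := by
    rw [← Real.exp_nat_mul]; congr 1; ring
  calc |(E.LFunction n : ℝ)| * logCubeIntegral (2 * Real.pi * (n : ℝ) * (Real.sqrt 5077)⁻¹)
      ≤ (n : ℝ) ^ 2 * (6 * Real.exp (-(x₁ * n)) / (x₁ * n) ^ 4) :=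
        mul_le_mul ha hI hI0 (by positivity)
    _ = 6 / (n ^ 2 * x₁ ^ 4) * Real.exp (-x₁) ^ n := by
        rw [hexp]; field_simp
    _ ≤ 6 / (2500 * x₁ ^ 4) * Real.exp (-x₁) ^ n := by
        refine mul_le_mul_of_nonneg_right ?_ (pow_nonneg (Real.exp_pos _).le n)
        refine div_le_div_of_nonneg_left (by norm_num) (by positivity) ?_
        have hn2 : (2500 : ℝ) ≤ (n : ℝ) ^ 2 := by nlinarith
        exact mul_le_mul_of_nonneg_right hn2 (pow_pos hx 4).le

/-- `q = e^{-x₁} ≤ 0.9156` and `q⁵⁰ = e^{-50x₁} ≤ 0.01217` (one kernel exponential each).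
[cite: BuhlerGrossZagier1985, §4 (11)] -/
theorem exp_neg_x₁_bounds :
    Real.exp (-((8818125 : ℝ) / 100000000)) ≤ 9156 / 10000 ∧
      Real.exp (-((8818125 : ℝ) / 100000000)) ^ 50 ≤ 1217 / 100000 := by
  have hS : 0 < 18446744073709551616 := by norm_num
  have h1 := esum_le_of_checkUB hS (K := 12) (k := 7) (bn := 9156) (bd := 10000) (by norm_num)
    (L := [⟨1, 1, -8818125, 100000000⟩]) (by decide +kernel)
  have h2 := esum_le_of_checkUB hS (K := 12) (k := 7) (bn := 1217) (bd := 100000) (by norm_num)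
    (L := [⟨1, 1, -(8818125 * 50), 100000000⟩]) (by decide +kernel)
  simp only [esum, ETerm.val, add_zero] at h1 h2
  push_cast at h1 h2
  refine ⟨?_, ?_⟩
  · have e : -(8818125 : ℝ) / 100000000 = -((8818125 : ℝ) / 100000000) := by ring
    rw [e] at h1; linarith
  · rw [← Real.exp_nat_mul]
    have e : ((50 : ℕ) : ℝ) * -((8818125 : ℝ) / 100000000) = -(8818125 * 50) / 100000000 := by
      push_cast; ring
    rw [e]; linarith

/-- **Summability and the tail**: the BGZ series `∑ aₙ I(n)` is absolutely summable and
`|∑_{n≥50} aₙ I(n)| ≤ 6` (geometric majorant `C q^n`, `C q⁵⁰/(1−q) ≤ 5.8`).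
[cite: BuhlerGrossZagier1985, §4 (11)] -/
theorem summable_bgzSum_and_tail :
    Summable (fun n : ℕ ↦
      (E.LFunction n : ℝ) * logCubeIntegral (2 * Real.pi * (n : ℝ) * (Real.sqrt 5077)⁻¹)) ∧
    |∑' n : ℕ, (E.LFunction (n + 50) : ℝ) *
        logCubeIntegral (2 * Real.pi * ((n + 50 : ℕ) : ℝ) * (Real.sqrt 5077)⁻¹)| ≤ 6 := by
  obtain ⟨hq1, hq50⟩ := exp_neg_x₁_bounds
  set x₁ : ℝ := (8818125 : ℝ) / 100000000 with hx₁
  set q : ℝ := Real.exp (-x₁) with hq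
  set C : ℝ := 6 / (2500 * x₁ ^ 4) with hC
  set T : ℕ → ℝ := fun n ↦
    (E.LFunction n : ℝ) * logCubeIntegral (2 * Real.pi * (n : ℝ) * (Real.sqrt 5077)⁻¹) with hT
  have hq0 : 0 ≤ q := (Real.exp_pos _).le
  have hq1' : q < 1 := by linarith
  have hC0 : 0 ≤ C := by rw [hC, hx₁]; positivity
  -- termwise bound on the shifted tail
  have hbound : ∀ i : ℕ, ‖T (i + 50)‖ ≤ C * q ^ 50 * q ^ i := by
    intro i
    rw [Real.norm_eq_abs, mul_assoc, ← pow_add, add_comm 50 i]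
    have h := abs_bgzTerm_le (n := i + 50) (by omega)
    simpa [hT, hC, hq, hx₁] using h
  have hgeom : HasSum (fun i : ℕ ↦ C * q ^ 50 * q ^ i) (C * q ^ 50 * (1 - q)⁻¹) :=
    (hasSum_geometric_of_lt_one hq0 hq1').mul_left _
  have htail_summable : Summable (fun i : ℕ ↦ T (i + 50)) :=
    Summable.of_norm_bounded hgeom.summable hbound
  have hsum : Summable T := (summable_nat_add_iff 50).mp htail_summable
  refine ⟨hsum, ?_⟩
  have h := tsum_of_norm_bounded hgeom hbound
  rw [Real.norm_eq_abs] at h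
  refine h.trans ?_
  -- `C q⁵⁰/(1-q) ≤ 6`
  have h1q : 0 < 1 - q := by linarith
  rw [← div_eq_mul_inv, div_le_iff₀ h1q]
  have hC' : C ≤ 397 / 10 := by
    rw [hC, hx₁]; norm_num
  have hprod : C * q ^ 50 ≤ 397 / 10 * (1217 / 100000) :=
    mul_le_mul hC' hq50 (pow_nonneg hq0 50) (by norm_num)
  have h6 : (397 : ℝ) / 10 * (1217 / 100000) ≤ 6 * (1 - 9156 / 10000) := by norm_num
  have h7 : (6 : ℝ) * (1 - 9156 / 10000) ≤ 6 * (1 - q) := by linarith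
  exact hprod.trans (h6.trans h7)

/-- The BGZ series of `5077a` is summable. [cite: BuhlerGrossZagier1985, §4 (11)] -/
theorem summable_bgzSum :
    Summable (fun n : ℕ ↦
      (E.LFunction n : ℝ) * logCubeIntegral (2 * Real.pi * (n : ℝ) * (Real.sqrt 5077)⁻¹)) :=
  summable_bgzSum_and_tail.1

/-- **The Buhler–Gross–Zagier sum of `5077a` is positive**:
`0 < ∑_{n≥1} aₙ(E) ∫_1^∞ e^{-2πny/√5077}(log y)³ dy` (`= Λ‴(E,1)/2`; BGZ (14):
`L‴(E,1)/3! = 1.7318…`). Finite part `≥ 31.18` by kernel enclosures, tail `≥ −6`.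
[cite: BuhlerGrossZagier1985, §4 (14)] -/
theorem bgzSum_pos :
    0 < ∑' n : ℕ,
      (E.LFunction n : ℝ) * logCubeIntegral (2 * Real.pi * (n : ℝ) * (Real.sqrt 5077)⁻¹) := by
  obtain ⟨hsum, htail⟩ := summable_bgzSum_and_tail
  rw [← hsum.sum_add_tsum_nat_add 50]
  have h1 := bgzSum_range_fifty_ge
  have h2 := (abs_le.mp htail).1
  push_cast at h2 ⊢
  linarith

end Literature.NumberTheory.EllipticCurves.Curve5077a
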